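import Summits.CriticalPhenomena.CardyFormulaZ2.Theses.CardyQContinuation
import Literature.Probability.Percolation.InterfaceScalingLimitDiscretised
import Literature.Probability.Percolation.BoxCrossingJordan
import Literature.Probability.RandomPlanarGeometry.SLESixCrossingNondegenerate
import Literature.Probability.RandomPlanarGeometry.CritPercSLELocalityProofs
import Literature.Probability.RandomPlanarGeometry.CritPercSLELocalityItoProofs
import Literature.Probability.RandomPlanarGeometry.CritPercSLESimplePathHolds
import Literature.Probability.RandomPlanarGeometry.ConformalMapCaratheodoryProofs
import Literature.Probability.RandomPlanarGeometry.SLETargetIndependenceSix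
import Literature.Probability.RandomPlanarGeometry.SLEExistenceNeEightHolds

/-!
# Line `kappa-free-splitting` — birth skeleton (BC3) for crux `CardyRigidity` (stmt-CriticalPhenomena-0746)

Published as `Lines/kappa-free-splitting.lean` (a sibling seat of the same unit registered `Lines/birth.lean`
concurrently, 2026-08-17T02:04:57Z; not overwritten).  Namespace kept `…Cruxes.CardyRigidity.Birth`.

Route `CardyQContinuation` r4 (the crux is SHARED verbatim by `CardyUniqueLimit` r2, `CardyTensorRG`,
`CardyCapacityWard`, `CardyOrderDuality`, `CardyWhiteToColoured`, `PivotalEnergyLaw`,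
`CardyStressTensorWard`; all eight decls have the same body, so `CardyRigidity_of` proves each of
them after `Iff.rfl`).

    CardyRigidity := ∀ f, (∀ R, R.HasCrossingLimit (bondDomainCrossingProb R) f) → EqOn f F (Ioo 0 1)

"If the bond-ℤ² crossing probabilities of ALL conformal rectangles converge to one function `f` of
the cross-ratio, then `f` is Cardy's function."  The line is the one recorded in the item's informal
text (Smirnov 2001 Thm 2 / Camia–Newman 2007 §§5–7 / Werner 2007 §3 / Schramm 2000 §1.5 /
Lawler–Schramm–Werner 2001 §§2–3), cut into THREE registered stubs along its literature steps (device of D-0027 §3.3: each stub is a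
sorried `protected theorem Holds.stub_<name> : <statement>` plus the by-name handle
`def stub_<name> : Prop := type_of% Holds.stub_<name>`; the hypotheses of `CardyRigidity_of` are the
three handles, by name); every
step that is already a tree theorem is used in the composition `CardyRigidity_of` (a real proof):

* STUB A `stub_interfacesToSLE` (XL, the heart: Camia–Newman with an UNKNOWN kernel).  From the
  crossing hypothesis, the medial exploration interface of bond percolation converges in law, for
  every Dobrushin domain and every admissible ℤ²-discretisation family, to chordal SLE_κ for ONE
  `κ > 0` (tightness `isTightLaws_map_bondInterface` is a tree fact; subsequential limits are
  identified through `f` as exit-distribution kernel + Schramm's principle; `κ` is NOT asserted to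
  be `> 4` or `= 6` — the composition derives both).  Conclusion typed exactly as the tree conjecture
  `SLE6LimitZ2AllDiscretisations` with `6 ↦ κ`.
* STUB B `stub_crossingReadout` (L; portmanteau for the crossing event, cf. crux
  `SLESixFamiliesGiveCardy` of route `CardyComplexCone` run at `κ`).  Under the crossing hypothesis
  AND interface convergence to SLE_κ, every SLE_κ law of `(Ω; a, c)` hits `(cd)` before `(bc)` with
  probability `f(η)`: both numbers are limits of `bondDomainCrossingProb R δ`.
* STUB C `stub_limitIsTargetIndependent` (L; LSW locality, SPLITTING form, passes to the limit).
  If the interfaces converge to SLE_κ for all domains and families, some family of chordal SLE_κ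
  laws is target independent (`ChordalFamily.IsTargetIndependent`, LSW 2001 Cor. 2.3 / Werner 2007
  Prop. 3.4): at the lattice level the explorations of `(D; a, b)` and `(D; a, b')` coincide until
  they reach the arc `[b, b']` (exactly, for hands-off discretisations, cf. the `LagHandOff`
  machinery `stub_discreteSplitting` of route `CardySelfRefinement`; families exist for every
  Dobrushin domain by the tree theorem `…LagHandOff.HittingTournament.stub_discretisable`).
* COMPOSITION `CardyRigidity_of` (PROVED here, ≈ 45 lines): A gives `κ > 0` and the SLE_κ limits;
  C gives a target-independent family `Q` of SLE_κ laws; `κ > 4` because for `κ ≤ 4` STUB B and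
  Rohde–Schramm's simple phase (`measureReal_hitsBefore_eq_zero_of_le_four` fed with
  `ae_isSimpleTrace_sleTrace_of_le_four_holds`, `JordanDomain.exists_continuousOn_extension_holds`)
  would give `f(η) = 0` at the modulus of the unit-disc rectangle, contradicting RSW
  (`discreteCrossingProb_clusterPt_mem_Ioo_holds`: every cluster point of the crossing probabilities
  lies in `(0,1)`); then `κ = 6` by the PROVED Lawler–Schramm–Werner characterisation
  `eq_six_of_isSLELaw_of_isTargetIndependent_of_four_lt`; finally for `η ∈ (0,1)` a rectangle with
  an SLE₆ law and a uniformizing datum of cross-ratio `η` exists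
  (`exists_isSLELaw_cardyFunction_crossRatio_eq_at`, `exists_isSLECurve_six`, injectivity of `F` on
  `[0,1]`), where B evaluates `f η` as the SLE₆ crossing probability `= F η`
  (`sle_six_measureReal_hitsBefore_holds`, Cardy's formula for SLE₆, proved in the tree).

## Disproof used
No `Cruxes/CardyRigidity/Disproof.lean` exists for this crux (`ledger crux ls`, 2026-08-17: no
workfiles): no `_false_without_` obstruction to honour, no landed `Negative/` lemma to import.
Negatives index honoured: stmt-0698 (`¬ SymmetryUpgrade`: "local Markov similarity-covariant
non-tracing family ⇒ SLE₆" is FALSE, fat-germ surgery) — no stub asserts an axioms-⇒-SLE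
characterisation: STUB C produces a family of SLE_κ LAWS and the κ-pinning is the proved LSW
theorem; stmt-0748 (`NegDegenerateArcs` refuted) is USED positively (RSW cluster points in `(0,1)`).

## Barriers
`EmbeddingModulusUniqueness` (Beffara 2008 Prop. 4): not embedding-blind — conformal data enter
through the hypothesis (a kernel of the CROSS-RATIO) and through SLE; `SmirnovTriangularOnly`,
`FKParafermionicHalfCauchyRiemann`, `CoveringLatticeShift`: no discrete holomorphic observable and no
lattice rewriting is used — the line starts from an assumed conformally invariant kernel.
-/

noncomputable section

open scoped NNReal
open MeasureTheory Filter Set Topology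
open UpperHalfPlane (upperHalfPlaneSet)
open Literature.Probability.RandomPlanarGeometry Literature.Probability.LatticeModels
open Literature.Probability.Percolation hiding cardyFunction

namespace Summit.CriticalPhenomena.CardyFormulaZ2.Cruxes.CardyRigidity.Birth

/-- STUB A — **interfaces converge to some SLE_κ** (Camia–Newman 2007 §§5–7 / Smirnov 2001 Thm 2
run with the unknown conformally invariant crossing kernel `f`; Aizenman–Burchard tightness; Schramm
2000 §1.5).  If the bond-ℤ² crossing probabilities of all conformal rectangles converge to `f` of
the cross-ratio, then there is `κ > 0` such that for every Dobrushin domain `D` and every admissible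
ℤ²-discretisation family `E` of `D` the medial exploration interface `bondInterfaceIn D (E δ)` of
`P_{1/2}` converges in law to chordal SLE_κ in `D` (the form of `SLE6LimitZ2AllDiscretisations`). -/
protected theorem Holds.stub_interfacesToSLE :
    ∀ f : ℝ → ℝ,
      (∀ R : ConformalRectangle, R.HasCrossingLimit (bondDomainCrossingProb R) f) →
      ∃ κ : ℝ≥0, 0 < κ ∧
        ∀ (D : DobrushinDomain) (E : ℝ → DiscreteDobrushin), ZdDiscretisationFamily D E →
          ConvergesInLawToSLE κ D (Ωδ := fun _ ↦ BondConfig (Site 2))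
            (fun δ ↦ bondInterfaceIn D (E δ)) fun _ ↦ bondPercolation (zdGraph 2) half := by
  sorry

/-- By-name handle of the registered stub `Holds.stub_interfacesToSLE` (D-0027 §3.3 device). -/
def stub_interfacesToSLE : Prop := type_of% Holds.stub_interfacesToSLE

/-- STUB B — **crossing readout** (portmanteau for the open-crossing event; cf. crux
`SLESixFamiliesGiveCardy`, Camia–Newman 2007 §7, Werner 2007 §3).  If the crossing probabilities
converge to `f` of the cross-ratio AND the interfaces converge to SLE_κ for all domains and
families, then in every conformal rectangle `R = (Ω; a, b, c, d)` every SLE_κ law of `(Ω; a, c)`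
hits `(cd)` before `(bc)` with probability `f (crossRatio x)` for every uniformizing datum `(φ, x)`:
the two limits of `bondDomainCrossingProb R δ` agree. -/
protected theorem Holds.stub_crossingReadout :
    ∀ (f : ℝ → ℝ) (κ : ℝ≥0), 0 < κ →
      (∀ R : ConformalRectangle, R.HasCrossingLimit (bondDomainCrossingProb R) f) →
      (∀ (D : DobrushinDomain) (E : ℝ → DiscreteDobrushin), ZdDiscretisationFamily D E →
          ConvergesInLawToSLE κ D (Ωδ := fun _ ↦ BondConfig (Site 2))
            (fun δ ↦ bondInterfaceIn D (E δ)) fun _ ↦ bondPercolation (zdGraph 2) half) →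
      ∀ (R : ConformalRectangle) (μ : Measure (CurveClass ℂ))
        (φ : ConformalEquiv upperHalfPlaneSet R.carrier) (x : Fin 4 → ℝ),
        IsSLELaw κ (R.chord 0 2 (by decide)) μ → R.IsUniformizing φ x →
          μ.real (CurveClass.hitsBefore (R.arc 2) (R.arc 1)) = f (crossRatio x) := by
  sorry

/-- By-name handle of the registered stub `Holds.stub_crossingReadout` (D-0027 §3.3 device). -/
def stub_crossingReadout : Prop := type_of% Holds.stub_crossingReadout

/-- STUB C — **locality (splitting form) passes to the scaling limit** (Lawler–Schramm–Werner 2001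
Cor. 2.3 / Werner 2007 Prop. 3.4: the percolation exploration from `a` in `(D; a, b, b')` does not
know its target before it reaches the arc `[b, b']`; passage to the limit as in the `LagHandOff`
machinery of route `CardySelfRefinement`).  If the interfaces converge to SLE_κ for all domains and
families, then some family of chordal SLE_κ laws (one for each Dobrushin domain) is target
independent. -/
protected theorem Holds.stub_limitIsTargetIndependent :
    ∀ κ : ℝ≥0, 0 < κ →
      (∀ (D : DobrushinDomain) (E : ℝ → DiscreteDobrushin), ZdDiscretisationFamily D E →
          ConvergesInLawToSLE κ D (Ωδ := fun _ ↦ BondConfig (Site 2))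
            (fun δ ↦ bondInterfaceIn D (E δ)) fun _ ↦ bondPercolation (zdGraph 2) half) →
      ∃ Q : ChordalFamily,
        (∀ D : DobrushinDomain, IsSLELaw κ D (Q D)) ∧ Q.IsTargetIndependent := by
  sorry

/-- By-name handle of the registered stub `Holds.stub_limitIsTargetIndependent` (D-0027 §3.3 device). -/
def stub_limitIsTargetIndependent : Prop := type_of% Holds.stub_limitIsTargetIndependent

/-- The unit-disc rectangle with its last mark dropped: a three-marked Jordan domain, the witness
the Lawler–Schramm–Werner characterisation is read at. -/
def threeMarkedDisc : MarkedDomain 3 where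
  toJordanDomain := ConformalRectangle.unitDisc.toJordanDomain
  mark i := ConformalRectangle.unitDisc.mark i.castSucc
  strictMono_mark _ _ h :=
    ConformalRectangle.unitDisc.strictMono_mark (Fin.castSucc_lt_castSucc_iff.mpr h)
  mark_mem i := ConformalRectangle.unitDisc.mark_mem i.castSucc

/-- **Composition** (kernel-checked, no `sorry`): STUBS A–C imply the crux `CardyRigidity` of
route `CardyQContinuation` (stmt-CriticalPhenomena-0746). -/
theorem CardyRigidity_of :
    stub_interfacesToSLE → stub_crossingReadout → stub_limitIsTargetIndependent →
      Summit.CriticalPhenomena.CardyFormulaZ2.Theses.CardyQContinuation.CardyRigidity := by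
  intro hA hB hC
  dsimp only [stub_interfacesToSLE, stub_crossingReadout, stub_limitIsTargetIndependent] at hA hB hC
  intro f hf η hη
  -- STUB A: the interfaces converge to SLE_κ for one κ > 0
  obtain ⟨κ, hκ, hconv⟩ := hA f hf
  -- STUB C: a target-independent family of SLE_κ laws
  obtain ⟨Q, hQ, hT⟩ := hC κ hκ hconv
  -- κ > 4: otherwise the SLE_κ crossing probability vanishes (Rohde–Schramm simple phase), while
  -- by STUB B it is the limit f(η₀) of percolation crossing probabilities, which RSW keeps in (0,1)
  have h4 : 4 < κ := by
    refine lt_of_not_ge fun hle ↦ ?_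
    set R₀ : ConformalRectangle := ConformalRectangle.unitDisc
    obtain ⟨φ₀, x₀, hφ₀⟩ := MarkedDomain.exists_isUniformizing_holds R₀
    have hμ₀ : IsSLELaw κ (R₀.chord 0 2 (by decide)) (Q (R₀.chord 0 2 (by decide))) := hQ _
    have hzero : (Q (R₀.chord 0 2 (by decide))).real (CurveClass.hitsBefore (R₀.arc 2) (R₀.arc 1)) = 0 :=
      measureReal_hitsBefore_eq_zero_of_le_four
        (fun κ ↦ ae_isSimpleTrace_sleTrace_of_le_four_holds (κ := κ))
        JordanDomain.exists_continuousOn_extension_holds hκ hle R₀ hμ₀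
    have hker₀ := hB f κ hκ hf hconv R₀ _ φ₀ x₀ hμ₀ hφ₀
    have hf0 : f (crossRatio x₀) = 0 := hker₀.symm.trans hzero
    -- the crossing probabilities of R₀ tend to f (crossRatio x₀) = 0 …
    have htend : Tendsto (bondDomainCrossingProb R₀) (𝓝[>] 0) (𝓝 0) := by
      simpa only [hf0] using hf R₀ φ₀ x₀ hφ₀
    -- … so 0 is a cluster point, contradicting RSW
    have hclu : MapClusterPt (0 : ℝ) (𝓝[>] (0 : ℝ))
        (fun δ ↦ discreteCrossingProb half R₀.carrier δ (R₀.arc 0) (R₀.arc 2)) :=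
      mapClusterPt_def.2 (ClusterPt.of_le_nhds htend)
    exact (lt_irrefl (0 : ℝ)) (discreteCrossingProb_clusterPt_mem_Ioo_holds R₀ hclu).1
  -- Lawler–Schramm–Werner: a target-independent family of SLE_κ laws, κ > 4, has κ = 6 (tree theorem)
  have h6 : κ = 6 := eq_six_of_isSLELaw_of_isTargetIndependent_of_four_lt h4 hQ hT threeMarkedDisc
  subst h6
  -- realise η as the cross-ratio of a uniformizing datum of a rectangle carrying an SLE₆ law
  have hs : cardyFunction η ∈ Ioo (0 : ℝ) 1 := cardyFunction_mem_Ioo hη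
  obtain ⟨R, μ, φ, x, hμ, hφ, hval⟩ :=
    exists_isSLELaw_cardyFunction_crossRatio_eq_at (κ := 6) exists_isSLECurve_six hs
  have hx : crossRatio x ∈ Ioo (0 : ℝ) 1 :=
    ConformalRectangle.crossRatio_mem_Ioo_of_isUniformizing hφ
  have hmono : StrictMonoOn cardyFunction (Icc 0 1) := strictMonoOn_cardyFunction_holds
  have hxη : crossRatio x = η :=
    hmono.injOn ⟨hx.1.le, hx.2.le⟩ ⟨hη.1.le, hη.2.le⟩ hval
  -- STUB B at κ = 6: f (crossRatio x) is the SLE₆ crossing probability, = F (crossRatio x)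
  have hker : μ.real (CurveClass.hitsBefore (R.arc 2) (R.arc 1)) = f (crossRatio x) :=
    hB f 6 hκ hf hconv R μ φ x hμ hφ
  have hcardy : μ.real (CurveClass.hitsBefore (R.arc 2) (R.arc 1)) = cardyFunction (crossRatio x) :=
    sle_six_measureReal_hitsBefore_holds R hμ hφ
  rw [← hxη, ← hker, hcardy]

/-- The composition applied to the three registered stubs: the crux, conditionally on the stubs
(the only `sorry`s of this file are inside `stub_*`); checks that the stub statements are
literally the hypotheses of `CardyRigidity_of`. -/
theorem cardyRigidity_of_stubs :
    Summit.CriticalPhenomena.CardyFormulaZ2.Theses.CardyQContinuation.CardyRigidity :=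
  CardyRigidity_of Holds.stub_interfacesToSLE Holds.stub_crossingReadout
    Holds.stub_limitIsTargetIndependent

end Summit.CriticalPhenomena.CardyFormulaZ2.Cruxes.CardyRigidity.Birth

end
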